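import Summits.QuantumFields.YangMills.Theorems.BalabanUVNodesRateCarriersOfRecord13CoPH
import Summits.QuantumFields.BalabanUV.T4Continuum.Support.MinimalActionRate
import Literature.MathematicalPhysics.QuantumFieldTheory.Balaban1983to89.Node00.RateRecord11NE3Data
import Literature.MathematicalPhysics.QuantumFieldTheory.Balaban1983to89.B8Ineq130

/-!
# Route «BalabanUVNodes», crux K3⁷ `SpineGivenEndpointR13SepCoPH` (stmt-QuantumFields-20544) — node N16 = NE3, out-edge N16 → N19 ∕ N21: THE DATA OF RECORD ARE NOT SMALL-FIELD.
# Under the CONST pin (`(𝔯.lit …).ne3 k = ne3ConstLayerOfRecord₁₁ F N (ℓ₃ F)`, all `2L^m`-periodic `SU(N)` unit-lattice data) node N19's displayed side letter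
# `R.ne3.dom ⊆ sfClass 4 R.ne3.L R.ne3.Nper ε₁ 0` (dag-n19-d `…N19RateEdgeHolderD4` (v′-16), `ε₁ ≤ 1∕4`) is FALSE for even `N` (so at K3⁷'s `N = 2`); under the LOOSE pin
# (data cut by print's (7)-ball of radius `ε ∕ B`) it HOLDS at every radius `ε₁ ≥ ε ∕ B` — the kernel certificate behind this seat's DATUM-C1 (pub-ymgap INBOX l.28097)

Cell `pub-ymgap`, seat `pub-ymgap-dag-n16-e` (R134 acceleration seat (a), strategy s2 = BY-NAME KNIT at the record; HUMAN RULING D-0062; chair R424 venue), generation 16,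
module 44 (THEOREMS ONLY, 0 `def`, 0 `sorry`, standard axioms).  `--kind proof --supports stmt-QuantumFields-20544 --as helper` (count-neutral).
`bears_on: R4∕N16 · out-edge N16 → N19 ∕ N21 (stub 2 of K3⁷)`.

THE POINT (numbers).  Node N19's stub-2 road of record (`h19HolderD4_datumOfRecord₁₃CoPH_of_linkReading`, the `KeyedCoreEdgeHolderD4` producer; also `…HolderD4AtRuns ∕ Along`)
displays, at the bundle `R := rateCarriersOfRecord₁₃CoPH 𝔯 F θ hP g₀ os k`, the N16-side letters `ε₁ ≤ 1 ∕ 4 ∧ ε₁ ≤ R.ne3.b ∧ 4 * ε₁ ≤ c' ∧ R.ne3.dom ⊆ sfClass 4 R.ne3.L R.ne3.Nper ε₁ 0`: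
N16's DATA must lie in the level-0 small-field ball of radius `ε₁ ≤ 1∕4` (`MinimalActionRate.sfClass … ε₁ 0` = unitary ∧ `Nper`-periodic ∧ `SmallField · ε₁`, i.e. every plaquette
holonomy within `ε₁` of `1`, [Balaban1985Variational] (2)∕(6)).  §1: the all-data object of record `ne3DomOfRecord₁₁ F N 0 0` (RR-1: ALL `2L^m`-periodic `SU(N)`-valued unit-lattice
configurations) is NOT inside ANY small-field class of radius `< 2` when `N` is even: the periodic configuration with `−1` on the direction-0 bonds based on the hyperplanes
`2L^m ∣ x 1` and `1` elsewhere is a datum of record whose plaquette holonomy at the origin in the `(0,1)`-plane is `−1`, at distance `‖−1 − 1‖ = 2` from `1`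
(`not_ne3DomOfRecord₁₁_subset_sfClass`).  §2: hence under the CONST pin N19's side letter FAILS at every tuple and run length (`not_dom_subset_sfClass_of_pinnedConst`, pin in
hypothesis form — the `hpin` binder of this seat's ₁₃ home modules ∕ module 43's `N16PinnedConst`); under the LOOSE pin it HOLDS at every radius `ε₁ ≥ (ℓ₃ F).ε ∕ B F`
(`dom_subset_sfClass_of_pinnedLoose`; `SmallField.mono`).  So the (C1) word is decided by the consumer as typed today: N19 reads N16 at a LOOSE object.

HONEST FRAMING.  Kernel bookkeeping over landed definitions (one explicit lattice configuration, one plaquette holonomy, `‖(2 : M_N ℂ)‖ = 2`); no estimate; nothing of Bałaban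
asserted; N16 ∕ N19 NOT discharged; the skeleton of record (plan g82 v4 17c74fac) is the planner's and is NOT edited (none of its declarations is named); counts UNMOVED
(typed 28∕28 · discharged 5∕27, A 5∕28); one finite four-torus at fixed ε — NOT ℝ⁴ ∕ infinite volume ∕ OS ∕ mass gap ∕ Clay.
-/

set_option autoImplicit false

open scoped BigOperators Matrix Matrix.Norms.L2Operator
open NormedSpace

namespace Summit.QuantumFields.YangMills.BalabanUVNodes.N16PinnedDataSmallField

open Literature.MathematicalPhysics.QuantumFieldTheory.Balaban1983to89
open Literature.MathematicalPhysics.QuantumFieldTheory.Balaban1983to89.T4Continuum (T4Family ULoop)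
open B7Prop1Explicit
open T4AveragingDeficitWall (IsUnitaryCfg SmallField)
open T4AveragingDeficitWallBoundary (IsPeriodicCfg)
open Node00 (Stage13HParams NE3Objects₁₁ NE3Letters₁₁ ne3ConstLayerOfRecord₁₁ ne3NperOfRecord₁₁ ne3DomOfRecord₁₁ two_le_ne3NperOfRecord₁₁
  mem_ne3DomOfRecord₁₁_iff_periodic_su MatA)
open Summit.QuantumFields.BalabanUV.T4Continuum
open MinimalActionRate (sfClass)
open YMDAG.UVSplit (NE3Carriers ne3OfRecord₁₁ RateReading₁₃CoPH rateCarriersOfRecord₁₃CoPH)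

noncomputable section

variable {N : ℕ} [NeZero N]

/-! ## §1 The data of record are not small-field (even `N`) -/

/-- `‖(-1 : M_N ℂ) - 1‖ = 2` in the `ℓ²`-operator (C⋆) norm (`N ≥ 1`). [folklore] -/
theorem norm_neg_one_sub_one : ‖(-1 : MatA N) - 1‖ = 2 := by
  have h : (-1 : MatA N) - 1 = (-2 : ℂ) • (1 : MatA N) := by
    rw [neg_smul, two_smul]; abel
  rw [h, norm_smul, CStarRing.norm_one, mul_one]
  simp

omit [NeZero N] in
/-- `-1 ∈ SU(N)` for even `N`. [folklore] -/
theorem neg_one_mem_specialUnitaryGroup (hN : Even N) : (-1 : MatA N) ∈ Matrix.specialUnitaryGroup (Fin N) ℂ := by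
  rw [Matrix.mem_specialUnitaryGroup_iff, Matrix.mem_unitaryGroup_iff]
  refine ⟨by simp, ?_⟩
  rw [Matrix.det_neg, Matrix.det_one, mul_one, Fintype.card_fin]
  exact hN.neg_one_pow

/-- **THE ALL-DATA OBJECT OF RECORD IS NOT INSIDE ANY SMALL-FIELD CLASS OF RADIUS `< 2`** (even `N`; any block factor `L'` in the class's name, level 0): the periodic configuration
with `−1` on the direction-0 bonds based on the hyperplanes `2L^m ∣ x 1` and `1` elsewhere is a datum of record (`mem_ne3DomOfRecord₁₁_iff_periodic_su`) and its plaquette holonomy at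
the origin in the `(0,1)`-plane is `−1`, `‖−1 − 1‖ = 2`. [folklore] -/
theorem not_ne3DomOfRecord₁₁_subset_sfClass (F : T4Family) (hN : Even N) {ε₁ : ℝ} (hε₁ : ε₁ < 2) (L' : ℕ) :
    ¬ (ne3DomOfRecord₁₁ F N 0 0 ⊆ sfClass 4 L' (ne3NperOfRecord₁₁ F 0 0) ε₁ 0) := by
  classical
  -- the witness configuration: `-1` on the direction-0 bonds based on the hyperplanes `P ∣ x 1`, `1` elsewhere (`P` = the period of record `2L^m`)
  set V : (Fin 4 → ℤ) → Fin 4 → (MatA N)ˣ :=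
    fun x κ => if κ = 0 ∧ ((ne3NperOfRecord₁₁ F 0 0 : ℕ) : ℤ) ∣ x 1 then -1 else 1 with hV
  have hP1 : ¬ (((ne3NperOfRecord₁₁ F 0 0 : ℕ) : ℤ) ∣ 1) := by
    intro h
    have h2 := two_le_ne3NperOfRecord₁₁ F 0 0
    rw [← Nat.cast_one, Int.natCast_dvd_natCast, Nat.dvd_one] at h
    omega
  intro hsub
  -- (1) the witness is a datum of record: periodic with the period of record, `SU(N)`-valued
  have hmem : V ∈ ne3DomOfRecord₁₁ F N 0 0 := by
    rw [mem_ne3DomOfRecord₁₁_iff_periodic_su]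
    refine ⟨fun x v κ => ?_, fun x κ => ?_⟩
    · have hiff : ((ne3NperOfRecord₁₁ F 0 0 : ℕ) : ℤ) ∣ (x + ((ne3NperOfRecord₁₁ F 0 0 : ℕ) : ℤ) • v) 1 ↔
          ((ne3NperOfRecord₁₁ F 0 0 : ℕ) : ℤ) ∣ x 1 := by
        show ((ne3NperOfRecord₁₁ F 0 0 : ℕ) : ℤ) ∣ x 1 + ((ne3NperOfRecord₁₁ F 0 0 : ℕ) : ℤ) * v 1 ↔ _
        exact dvd_add_left (dvd_mul_right _ (v 1))
      show (if κ = 0 ∧ ((ne3NperOfRecord₁₁ F 0 0 : ℕ) : ℤ) ∣ (x + ((ne3NperOfRecord₁₁ F 0 0 : ℕ) : ℤ) • v) 1 then (-1 : (MatA N)ˣ) else 1) =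
        (if κ = 0 ∧ ((ne3NperOfRecord₁₁ F 0 0 : ℕ) : ℤ) ∣ x 1 then (-1 : (MatA N)ˣ) else 1)
      exact if_congr (Iff.rfl.and hiff) rfl rfl
    · by_cases h : κ = 0 ∧ ((ne3NperOfRecord₁₁ F 0 0 : ℕ) : ℤ) ∣ x 1
      · show (((if κ = 0 ∧ ((ne3NperOfRecord₁₁ F 0 0 : ℕ) : ℤ) ∣ x 1 then (-1 : (MatA N)ˣ) else 1) : (MatA N)ˣ) : MatA N) ∈ _
        rw [if_pos h, Units.val_neg, Units.val_one]
        exact neg_one_mem_specialUnitaryGroup hN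
      · show (((if κ = 0 ∧ ((ne3NperOfRecord₁₁ F 0 0 : ℕ) : ℤ) ∣ x 1 then (-1 : (MatA N)ˣ) else 1) : (MatA N)ˣ) : MatA N) ∈ _
        rw [if_neg h, Units.val_one]
        exact Submonoid.one_mem _
  -- (2) but its plaquette holonomy at the origin in the (0,1)-plane is `-1`
  obtain ⟨-, -, hsmall⟩ := hsub hmem
  have h01 : (0 : Fin 4) ≠ 1 := by decide
  have key := hsmall 0 0 1 h01
  have hV00 : V 0 0 = -1 := by
    show (if (0 : Fin 4) = 0 ∧ ((ne3NperOfRecord₁₁ F 0 0 : ℕ) : ℤ) ∣ (0 : Fin 4 → ℤ) 1 then (-1 : (MatA N)ˣ) else 1) = -1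
    rw [if_pos ⟨rfl, by simp⟩]
  have hV1 : ∀ y : Fin 4 → ℤ, V y 1 = 1 := fun y => by
    show (if (1 : Fin 4) = 0 ∧ ((ne3NperOfRecord₁₁ F 0 0 : ℕ) : ℤ) ∣ y 1 then (-1 : (MatA N)ˣ) else 1) = 1
    rw [if_neg (by simp)]
  have hVe1 : V (e 1) 0 = 1 := by
    show (if (0 : Fin 4) = 0 ∧ ((ne3NperOfRecord₁₁ F 0 0 : ℕ) : ℤ) ∣ (e 1 : Fin 4 → ℤ) 1 then (-1 : (MatA N)ˣ) else 1) = 1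
    rw [if_neg]
    simpa [e_apply] using hP1
  have hhol : hol V 0 (plaqWord 0 1) = -1 := by
    simp only [plaqWord, hol_cons, hol_nil, stepHol_true, stepHol_false, Letter.vec_true, Letter.vec_false, zero_add, mul_one]
    rw [show e (0 : Fin 4) + e 1 - e 0 = e 1 by abel, show e (0 : Fin 4) + e 1 + -e 0 - e 1 = 0 by abel, hV00, hV1, hVe1, hV1]
    simp
  rw [hhol, Units.val_neg, Units.val_one, norm_neg_one_sub_one, pow_zero, one_pow, div_one] at key
  linarith

/-! ## §2 At the bundle of record: the CONST pin fails N19's side letter, the LOOSE pin satisfies it -/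

section Pins

variable (𝔯 : RateReading₁₃CoPH N) (ℓ₃ : T4Family → NE3Letters₁₁)

/-- **UNDER THE CONST PIN N19's SIDE LETTER `R.ne3.dom ⊆ sfClass 4 R.ne3.L R.ne3.Nper ε₁ 0` FAILS** at every tuple and run length, for every `ε₁ < 2` (so for N19's `ε₁ ≤ 1∕4`),
even `N` — pin in hypothesis form (`hpin` = module 43's `N16PinnedConst 𝔯 ℓ₃` unfolded). [folklore] -/
theorem not_dom_subset_sfClass_of_pinnedConst (hN : Even N)
    (hpin : ∀ (F : T4Family) (θ : Stage13HParams F N) (hP : θ.Provisos₁₃CoPH F N) (g₀ : ℕ → ℝ) (os : List (ULoop F)) (k : ℕ),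
      (𝔯.lit F θ hP g₀ os).ne3 k = ne3ConstLayerOfRecord₁₁ F N (ℓ₃ F))
    (F : T4Family) (θ : Stage13HParams F N) (hP : θ.Provisos₁₃CoPH F N) (g₀ : ℕ → ℝ) (os : List (ULoop F)) (k : ℕ) {ε₁ : ℝ} (hε₁ : ε₁ < 2) :
    ¬ ((rateCarriersOfRecord₁₃CoPH 𝔯 F θ hP g₀ os k).ne3.dom ⊆
        sfClass 4 (rateCarriersOfRecord₁₃CoPH 𝔯 F θ hP g₀ os k).ne3.L (rateCarriersOfRecord₁₃CoPH 𝔯 F θ hP g₀ os k).ne3.Nper ε₁ 0) := by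
  show ¬ ((ne3OfRecord₁₁ F ((𝔯.lit F θ hP g₀ os).ne3 k)).dom ⊆
    sfClass 4 (ne3OfRecord₁₁ F ((𝔯.lit F θ hP g₀ os).ne3 k)).L (ne3OfRecord₁₁ F ((𝔯.lit F θ hP g₀ os).ne3 k)).Nper ε₁ 0)
  rw [hpin]
  exact not_ne3DomOfRecord₁₁_subset_sfClass F hN hε₁ _

omit [NeZero N] in
/-- The small-field class is monotone in its radius (level 0, any period ∕ block factor). [folklore] -/
theorem sfClass_zero_mono {L Nper : ℕ} {a a' : ℝ} (h : a ≤ a') : sfClass 4 L Nper a 0 ⊆ (sfClass 4 L Nper a' 0 : Set (Site 4 → Fin 4 → (MatA N)ˣ)) := by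
  rintro U ⟨hu, hp, hs⟩
  refine ⟨hu, hp, ?_⟩
  rw [pow_zero, one_pow, div_one] at hs ⊢
  exact MinimalActionRate.SmallField.mono hs h

/-- **UNDER THE LOOSE PIN N19's SIDE LETTER HOLDS AT EVERY RADIUS `ε₁ ≥ (ℓ₃ F).ε ∕ B F`** (pin in hypothesis form = module 43's `N16PinnedLoose 𝔯 ℓ₃ B` unfolded; the loose data
lie in print's (7)-ball by definition, `SmallField.mono` does the rest). [cite: Balaban1985Variational, (7) p.278] [folklore] -/
theorem dom_subset_sfClass_of_pinnedLoose (B : T4Family → ℝ)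
    (hpin : ∀ (F : T4Family) (θ : Stage13HParams F N) (hP : θ.Provisos₁₃CoPH F N) (g₀ : ℕ → ℝ) (os : List (ULoop F)) (k : ℕ),
      (𝔯.lit F θ hP g₀ os).ne3 k =
        { ne3ConstLayerOfRecord₁₁ F N (ℓ₃ F) with
          dom := {V | V ∈ ne3DomOfRecord₁₁ F N 0 0 ∧ V ∈ sfClass 4 F.L (ne3NperOfRecord₁₁ F 0 0) ((ℓ₃ F).ε / B F) 0} })
    (F : T4Family) (θ : Stage13HParams F N) (hP : θ.Provisos₁₃CoPH F N) (g₀ : ℕ → ℝ) (os : List (ULoop F)) (k : ℕ) {ε₁ : ℝ} (hε₁ : (ℓ₃ F).ε / B F ≤ ε₁) :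
    (rateCarriersOfRecord₁₃CoPH 𝔯 F θ hP g₀ os k).ne3.dom ⊆
      sfClass 4 (rateCarriersOfRecord₁₃CoPH 𝔯 F θ hP g₀ os k).ne3.L (rateCarriersOfRecord₁₃CoPH 𝔯 F θ hP g₀ os k).ne3.Nper ε₁ 0 := by
  show (ne3OfRecord₁₁ F ((𝔯.lit F θ hP g₀ os).ne3 k)).dom ⊆
    sfClass 4 (ne3OfRecord₁₁ F ((𝔯.lit F θ hP g₀ os).ne3 k)).L (ne3OfRecord₁₁ F ((𝔯.lit F θ hP g₀ os).ne3 k)).Nper ε₁ 0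
  rw [hpin]
  exact fun V hV => sfClass_zero_mono hε₁ hV.2

end Pins

/-! ## §3 (v1.1) The flat datum: loose data are NON-EMPTY at every radius `≥ 0`; the NE3-erased reading FAILS the loose pin (K3⁷ v5's guard is not vacuous in N16) -/

section Flat

omit [NeZero N] in
/-- **THE FLAT CONFIGURATION IS A DATUM OF RECORD** (`1` is `2L^m`-periodic and `SU(N)`-valued). [folklore] -/
theorem one_mem_ne3DomOfRecord₁₁ (F : T4Family) : (1 : (Fin 4 → ℤ) → Fin 4 → (MatA N)ˣ) ∈ ne3DomOfRecord₁₁ F N 0 0 := by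
  rw [mem_ne3DomOfRecord₁₁_iff_periodic_su]
  exact ⟨fun _ _ _ => rfl, fun _ _ => by rw [Pi.one_apply, Pi.one_apply, Units.val_one]; exact Submonoid.one_mem _⟩

omit [NeZero N] in
/-- **THE FLAT CONFIGURATION LIES IN EVERY LEVEL-0 SMALL-FIELD CLASS OF RADIUS `≥ 0`** (unitary, periodic, every plaquette holonomy `= 1` by `B8Ineq130.hol_one`). [folklore] -/
theorem one_mem_sfClass {L Nper : ℕ} {r : ℝ} (hr : 0 ≤ r) : (1 : Site 4 → Fin 4 → (MatA N)ˣ) ∈ sfClass 4 L Nper r 0 := by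
  refine ⟨fun _ _ => (B7Prop2Explicit.unitaryUnits (MatA N)).one_mem, fun _ _ _ => rfl, fun x κ κ' _ => ?_⟩
  rw [B8Ineq130.hol_one, Units.val_one, sub_self, norm_zero, pow_zero, one_pow, div_one]
  exact hr

omit [NeZero N] in
/-- **THE LOOSE DATA ARE NON-EMPTY AT EVERY RADIUS `ρ ≥ 0`** — the flat datum lies in them. [folklore] -/
theorem looseDom_nonempty (F : T4Family) {ρ : ℝ} (hρ : 0 ≤ ρ) :
    ({V | V ∈ ne3DomOfRecord₁₁ F N 0 0 ∧ V ∈ sfClass 4 F.L (ne3NperOfRecord₁₁ F 0 0) ρ 0} : Set ((Fin 4 → ℤ) → Fin 4 → (MatA N)ˣ)).Nonempty :=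
  ⟨1, one_mem_ne3DomOfRecord₁₁ F, one_mem_sfClass hρ⟩

/-- **GIVEN ONE STAGE-13 TUPLE WITH CORE PROVISOS, A READING WHOSE NE3 DATA ARE EMPTY FAILS THE LOOSE PIN AT EVERY RADIUS `(ℓ₃ F).ε ∕ B F ≥ 0`** — so K3⁷ v5's guard
`GuardedReadingN16` (whose rows give `0 < (ℓ₃ F).ε` from `N16LettersEnd` and `0 < B F` from `N16RadiusMatch`) EXCLUDES module 43's NE3-erased reading `eraseNE3 𝔯`: the N16
conjunct of `stub_rates13H` is no longer vacuous (module 43's `not_n16PinnedLoose_eraseNE3_of_nonempty` with its non-emptiness hypothesis DISCHARGED by the flat datum).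
Pin in hypothesis form (= `N16PinnedLoose 𝔯 ℓ₃ B` unfolded). [folklore] -/
theorem not_pinnedLoose_of_ne3_dom_empty (𝔯 : RateReading₁₃CoPH N) (ℓ₃ : T4Family → NE3Letters₁₁) (B : T4Family → ℝ)
    {F : T4Family} (θ : Stage13HParams F N) (hP : θ.Provisos₁₃CoPH F N) (g₀ : ℕ → ℝ) (os : List (ULoop F)) (k : ℕ)
    (hempty : ((𝔯.lit F θ hP g₀ os).ne3 k).dom = ∅) (hε : 0 ≤ (ℓ₃ F).ε) (hB : 0 < B F)
    (hpin : ∀ (F : T4Family) (θ : Stage13HParams F N) (hP : θ.Provisos₁₃CoPH F N) (g₀ : ℕ → ℝ) (os : List (ULoop F)) (k : ℕ),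
      (𝔯.lit F θ hP g₀ os).ne3 k =
        { ne3ConstLayerOfRecord₁₁ F N (ℓ₃ F) with
          dom := {V | V ∈ ne3DomOfRecord₁₁ F N 0 0 ∧ V ∈ sfClass 4 F.L (ne3NperOfRecord₁₁ F 0 0) ((ℓ₃ F).ε / B F) 0} }) : False := by
  have hne := looseDom_nonempty (N := N) F (div_nonneg hε hB.le)
  have h : (∅ : Set ((Fin 4 → ℤ) → Fin 4 → (MatA N)ˣ)) =
      {V | V ∈ ne3DomOfRecord₁₁ F N 0 0 ∧ V ∈ sfClass 4 F.L (ne3NperOfRecord₁₁ F 0 0) ((ℓ₃ F).ε / B F) 0} := by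
    rw [← hempty, hpin F θ hP g₀ os k]
  rw [← h] at hne
  exact Set.not_nonempty_empty hne

end Flat

end

end Summit.QuantumFields.YangMills.BalabanUVNodes.N16PinnedDataSmallField
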